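import Summits.HodgeConjecture.HodgeConjecture.Theorems.Ring2BindersVariationalHodgeQP
import HarnessLib

/-!
# Ring 2 — binder seat b03 (Hodge ladder stage 3): the printed-carrier node `VariationalHodgeQP` reaches every instance of
# the crux `VariationalHodge` whose anchor and target are LOCALLY PROJECTIVE points of the base (non-vacuous replacement of
# the `hqp`-theorems of `Ring2BindersVariationalHodgeQP`)

HONEST FRAMING: research route conditional on HC_CM; not a corollary; Q11.4-sentence-2 already refuted in dim ≥ 3.

Cell `pub-hodge-ring2`, Hodge ladder stage 3, binder seat `ring2-b03` (row b03 of `BINDER-OWNERS.md`: the route item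
`Theses.AnchorTransport.VariationalHodge`, stmt-HodgeConjecture-1076 — Grothendieck's variational Hodge conjecture in
global-class form over ALL smooth irreducible bases and ALL smooth proper families with projective fibres; OPEN).
`HC_CM` is not mentioned in any statement below; nothing here is a case of the Hodge conjecture; no definition, no named
fact, no `sorry`.

## Why this part exists (referee finding F-ref2-67 on the seat's junction `Ring2BindersVariationalHodgeQP`)

The junction proved (J1)/(J1′): `VariationalHodgeQP` (Charles–Schnell Conj. 11.3.1 on its printed carriers, typer2 part
XXVII) gives item 1076's conclusion for every family whose TOTAL SPACE is quasi-projective, over every smooth irreducible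
base; and (J3)/(J4): `VariationalHodge ↔ VariationalHodgeQP` GRANTED the blanket residual `hqp` ("every smooth proper family
with projective fibres over a smooth irreducible affine base has quasi-projective total space"). Referee 2 (REFEREE §74,
F-ref2-67) observed that `hqp` is false as a blanket statement (mixed small resolutions of a two-nodal quartic pencil,
Atiyah 1958; the AnchorTransport route's own docstrings), so (J3)/(J4) are VACUOUS: the honest content was (J1′) per
family. This part replaces the blanket hypothesis by the PER-INSTANCE, satisfiable one and proves the sharper statement:

* (J5) `variationalHodge_conclusion_of_variationalHodgeQP_of_locallyQuasiProjectiveAt` — **`VariationalHodgeQP` gives the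
  conclusion of item 1076 for every instance `(f, A, s₀, s)` such that `f` is quasi-projective over SOME open neighbourhood
  of the anchor `pt s₀` and over SOME open neighbourhood of the target `pt s`** (nothing is asked at the other points of
  the base, and neither `𝒳` nor `S` is assumed quasi-projective, separated or quasi-compact). Proof: the two
  neighbourhoods meet (irreducibility) in an open containing a closed point (Jacobson), which underlies a complex point
  `u`; go `s₀ → u` inside the first and `u → s` inside the second, each step being (J1) for the restricted family
  (`variationalHodge_step_of_isQuasiProjectiveOver_restrict`: base change to the open, `IsSmoothProjectiveFamily.familyPullback_snd`,
  transport of the data `Theorems.familyPullback_fibrewise_rational_hodgeType` /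
  `Theorems.map_fiberι_familyPullback_mem_algebraicClasses_iff`).
* (J5′) `variationalHodge_locallyQuasiProjective_of_variationalHodgeQP` (and the primed form in the exact `hloc` shape of
  `Ring2.Hypotheses.flatSections_locallyQuasiProjective_of_vhc`, whose base-quasi-projectivity conjunct is idle) — the
  node-level corollary: **the printed-carrier node covers every smooth projective family that is, locally on the base,
  carried by quasi-projective schemes**; `variationalHodgeQP_iff_locallyQuasiProjective` — XXVII's node IS that statement.
  Global-class twin of ring2-b04's `flatSection_algebraic_of_flatSectionsAlgebraicQP_of_locallyQuasiProjective`.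
* (J5″) `variationalHodge_projective_of_variationalHodgeQP` — in particular every family PROJECTIVE in Hartshorne's sense
  (`𝒳 ↪ ℙᴺ × S` closed, then the projection — the "smooth projective morphism" of the printed conjecture) over ANY smooth
  irreducible base (count once: this is (J1) fed to the route's `Theorems.variationalHodge_projective_of_quasiProjective`).
* (J7) `vhc_iff_variationalHodgeQP_and_nonLocallyProjectiveEndpoints` — **exactness of row b03 against its printed-carrier
  node, non-vacuously**: `VariationalHodge` is EQUIVALENT to `VariationalHodgeQP` together with the instances of item 1076
  whose anchor or target is NOT a locally-quasi-projective point of the family. That second conjunct — the "Atiyah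
  class" of F-ref2-67, pointwise — is the precise complement on which the printed conjecture is silent; it is implied
  by the Hodge conjecture (`Ring2.Hypotheses.vhc_of_hodgeConjecture`) and is not known to be false, so (J7) has content
  where (J3)/(J4) had none.

What is NOT claimed: that smooth proper families with projective fibres are locally projective over curve bases — false
in general, and false already for SCHEMES: e.g. for a general pencil of quartic surfaces containing a fixed line `L`
through the two nodes `p, q` of one member, the total space has ordinary double points at `p, q`, the surface swept by `L`
is a Weil divisor through both, and the MIXED small resolution (blow up that divisor near `p`, a residual divisor of the
opposite local class near `q`, glue) is a smooth scheme, proper and smooth over the smooth locus of the pencil, with smooth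
quartic / K3 fibres, and NOT quasi-projective over any neighbourhood of the nodal parameter as soon as the generic Picard
group of the pencil is spanned by the hyperplane class and `L` (every line bundle then has opposite degrees on the two
exceptional curves); cf. Atiyah 1958 for the simultaneous resolutions. It is TRUE for abelian schemes over normal bases
of dimension `≤ 1` (Raynaud 1970, XI 1.4), so for sectioned abelian families over curves the distinction is void (row b02
is ring2-b02's `Ring2BindersAbelianSchemeVHCSection`). Nor is anything claimed about flat sections of the espace étalé
(row b04, now `≡ b03` binder-free by ring2-b01/b04's `flatSectionsAlgebraic_iff_vhc`), or about `HC_AV` / `HC_CM`.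

References: [CharlesSchnell2014Notes] Conj. 11.3.1 (= arXiv:1101.3647 Conj. 30), Prop. 11.3.5; [Grothendieck1966]
footnote 13; [Hartshorne1977] II §4 (projective and quasi-projective morphisms); [Atiyah1958] §4 (simultaneous small
resolutions); [Raynaud1970] Ch. XI (abelian schemes over a normal base of dimension ≤ 1 are projective).
-/

-- every declaration of this problem lives in `Summit.HodgeConjecture.HodgeConjecture.…` (summit = sub-problem);
-- namespace `…Ring2.Binders` = the binder seats of the cell's Hodge-ladder stage 3 (`BINDER-OWNERS.md`)
set_option linter.dupNamespace false

noncomputable section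

open CategoryTheory AlgebraicGeometry MonoidalCategory
open Literature.AlgebraicGeometry Literature.AlgebraicGeometry.Motives
open Literature.AlgebraicGeometry.HodgeTheory

namespace Summit.HodgeConjecture.HodgeConjecture.Ring2.Binders

open Summit.HodgeConjecture.HodgeConjecture.Ring2.Hypotheses

/-! ## §1 One step inside an open of the base over which the family is quasi-projective -/

section Step

variable {n : ℕ} {𝒳 S : SchemeOver ℂ} (f : 𝒳 ⟶ S)

/-- **One step inside an open `U ⊆ S` over which the total space is quasi-projective.** For a smooth projective family
`f : 𝒳 ⟶ S` over a smooth irreducible `S`, a global class `A` with rational `(p,p)` fibre restrictions, and an open `U`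
such that `𝒳 ×_S U` is quasi-projective over `ℂ`, algebraicity of `A|_{𝒳_a}` passes to `A|_{𝒳_b}` for any two complex
points `a`, `b` of `U`, granted `VariationalHodgeQP`: restrict the family to `U` (irreducible as a non-empty open of an
irreducible space, smooth over `ℂ`; `IsSmoothProjectiveFamily.familyPullback_snd`), lift `a`, `b`
(`AlgPoints.range_map_of_isOpenImmersion_holds`), move the data over (`Theorems.familyPullback_fibrewise_rational_hodgeType`,
`Theorems.map_fiberι_familyPullback_mem_algebraicClasses_iff`) and apply (J1)
`variationalHodge_quasiProjective_of_variationalHodgeQP` to the restricted family — whose base `U` need not be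
quasi-projective. [cite: CharlesSchnell2014Notes, Conj. 11.3.1] [cite: Hartshorne1977, Ch. II §4 p. 103] -/
theorem variationalHodge_step_of_isQuasiProjectiveOver_restrict (hV : VariationalHodgeQP)
    (hf : IsSmoothProjectiveFamily f n) [IrreducibleSpace S.left] [AlgebraicGeometry.Smooth S.hom]
    (p : ℕ) (A : complexBetti 𝒳 (2 * p))
    (hA : ∀ s : ComplexPoints S, IsRationalClass (complexBetti.map (fiberι f s) (2 * p) A) ∧
      IsOfHodgeType n (fiberOver f s) (2 * p) p p (complexBetti.map (fiberι f s) (2 * p) A))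
    (U : S.left.Opens) (hU : IsQuasiProjectiveOver (familyPullback f (openSubschemeOverι S U)))
    (a b : ComplexPoints S) (haU : a.pt ∈ U) (hbU : b.pt ∈ U)
    (ha : complexBetti.map (fiberι f a) (2 * p) A ∈ algebraicClasses (fiberOver f a) p) :
    complexBetti.map (fiberι f b) (2 * p) A ∈ algebraicClasses (fiberOver f b) p := by
  -- the open `U` as a smooth irreducible `ℂ`-scheme `openSubschemeOverι S U : U ⟶ S`
  haveI : IsOpenImmersion (openSubschemeOverι S U).left := inferInstanceAs (IsOpenImmersion U.ι)
  have hUirr : IrreducibleSpace (openSubschemeOver S U).left := by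
    change IrreducibleSpace U
    exact isIrreducible_iff_irreducibleSpace.mp ⟨⟨a.pt, haU⟩,
      (PreirreducibleSpace.isPreirreducible_univ (X := S.left)).open_subset U.isOpen
        (Set.subset_univ _)⟩
  have hUsm : AlgebraicGeometry.Smooth (openSubschemeOver S U).hom := by
    change AlgebraicGeometry.Smooth (U.ι ≫ S.hom)
    infer_instance
  -- lift `a`, `b` to `U`
  have hrange : Set.range (AlgPoints.map (L := ℂ) (openSubschemeOverι S U)) = {P | P.pt ∈ U} := by
    rw [AlgPoints.range_map_of_isOpenImmersion_holds]
    ext P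
    change P.pt ∈ U.ι.opensRange ↔ P.pt ∈ U
    rw [Scheme.Opens.opensRange_ι]
  obtain ⟨a', rfl⟩ : a ∈ Set.range (AlgPoints.map (L := ℂ) (openSubschemeOverι S U)) := by
    rw [hrange]; exact haU
  obtain ⟨b', rfl⟩ : b ∈ Set.range (AlgPoints.map (L := ℂ) (openSubschemeOverι S U)) := by
    rw [hrange]; exact hbU
  -- base change to `U`, apply (J1) to the restricted family (quasi-projective total space), come back
  rw [← Theorems.map_fiberι_familyPullback_mem_algebraicClasses_iff f (openSubschemeOverι S U) hf A b']
  exact variationalHodge_quasiProjective_of_variationalHodgeQP hV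
    (familyPullback.snd f (openSubschemeOverι S U)) (hf.familyPullback_snd _) hU hUirr hUsm p
    (complexBetti.map (familyPullback.fst f (openSubschemeOverι S U)) (2 * p) A)
    (Theorems.familyPullback_fibrewise_rational_hodgeType f (openSubschemeOverι S U) A hA)
    ⟨a', (Theorems.map_fiberι_familyPullback_mem_algebraicClasses_iff f (openSubschemeOverι S U) hf
      A a').2 ha⟩
    b'

/-! ## §2 (J5) The two-point theorem: local quasi-projectivity at the anchor and at the target suffices -/

/-- **(J5) `VariationalHodgeQP` settles every instance of item 1076 whose anchor and target are locally quasi-projective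
points of the family.** Let `f : 𝒳 ⟶ S` be a smooth projective family (smooth, proper, projective fibres) over a smooth
irreducible `S`, `A ∈ H²ᵖ(𝒳(ℂ); ℂ)` with rational `(p,p)` fibre restrictions, `A|_{𝒳_{s₀}}` algebraic. If `pt s₀` has an
open neighbourhood `U₀` and `pt s` an open neighbourhood `U₁` with `𝒳 ×_S U₀`, `𝒳 ×_S U₁` quasi-projective over `ℂ`,
then `A|_{𝒳_s}` is algebraic. Proof: `U₀ ∩ U₁ ≠ ∅` (irreducibility) contains a closed point (Jacobson, Mathlib
`nonempty_inter_closedPoints`) underlying a complex point `u` (`EsnaultLevineViehweg.exists_algPoints_pt_eq`); go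
`s₀ → u` inside `U₀` and `u → s` inside `U₁` (`variationalHodge_step_of_isQuasiProjectiveOver_restrict`). No hypothesis
at the other points of `S`: the family may fail to be locally projective elsewhere. This is the non-vacuous form of
(J3): the printed conjecture on its carriers reaches the crux AS FILED at every pair of locally projective points.
[cite: CharlesSchnell2014Notes, Conj. 11.3.1] [cite: Grothendieck1966, footnote 13] -/
theorem variationalHodge_conclusion_of_variationalHodgeQP_of_locallyQuasiProjectiveAt (hV : VariationalHodgeQP)
    (hf : IsSmoothProjectiveFamily f n) [IrreducibleSpace S.left] [AlgebraicGeometry.Smooth S.hom]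
    (p : ℕ) (A : complexBetti 𝒳 (2 * p))
    (hA : ∀ s : ComplexPoints S, IsRationalClass (complexBetti.map (fiberι f s) (2 * p) A) ∧
      IsOfHodgeType n (fiberOver f s) (2 * p) p p (complexBetti.map (fiberι f s) (2 * p) A))
    {s₀ : ComplexPoints S}
    (h₀ : ∃ U : S.left.Opens, s₀.pt ∈ U ∧ IsQuasiProjectiveOver (familyPullback f (openSubschemeOverι S U)))
    (hs₀ : complexBetti.map (fiberι f s₀) (2 * p) A ∈ algebraicClasses (fiberOver f s₀) p)
    (s : ComplexPoints S)
    (h₁ : ∃ U : S.left.Opens, s.pt ∈ U ∧ IsQuasiProjectiveOver (familyPullback f (openSubschemeOverι S U))) :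
    complexBetti.map (fiberι f s) (2 * p) A ∈ algebraicClasses (fiberOver f s) p := by
  obtain ⟨U₀, h₀U, hU₀⟩ := h₀
  obtain ⟨U₁, h₁U, hU₁⟩ := h₁
  haveI : LocallyOfFiniteType S.hom := inferInstance
  haveI : JacobsonSpace S.left := LocallyOfFiniteType.jacobsonSpace S.hom
  have hne : ((U₀ : Set S.left) ∩ (U₁ : Set S.left)).Nonempty := by
    obtain ⟨x, -, hx⟩ := (PreirreducibleSpace.isPreirreducible_univ (X := S.left)) _ _ U₀.isOpen
      U₁.isOpen ⟨s₀.pt, Set.mem_univ _, h₀U⟩ ⟨s.pt, Set.mem_univ _, h₁U⟩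
    exact ⟨x, hx⟩
  obtain ⟨y, ⟨hy₀, hy₁⟩, hyc⟩ :=
    nonempty_inter_closedPoints hne (U₀.isOpen.inter U₁.isOpen).isLocallyClosed
  obtain ⟨u, rfl⟩ := EsnaultLevineViehweg.exists_algPoints_pt_eq (X := S) (k := ℂ) hyc
  exact variationalHodge_step_of_isQuasiProjectiveOver_restrict f hV hf p A hA U₁ hU₁ u s hy₁ h₁U
    (variationalHodge_step_of_isQuasiProjectiveOver_restrict f hV hf p A hA U₀ hU₀ s₀ u h₀U hy₀ hs₀)

end Step

/-! ## §3 (J5′) Node level: the printed-carrier node covers every locally quasi-projective family -/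

/-- **(J5′) `VariationalHodgeQP` gives the global-class variational Hodge statement for every smooth projective family
that is, locally on the base, carried by quasi-projective schemes** — over ANY smooth irreducible base (no
quasi-projectivity, separatedness or quasi-compactness of `S`; no global quasi-projectivity of `𝒳`). Hypothesis: every
point of `S` has an open neighbourhood `U` with `𝒳 ×_S U` quasi-projective over `ℂ`. Immediate from the two-point
theorem (J5) at `pt s₀` and `pt s`. Global-class twin of ring2-b04's
`Ring2.Hypotheses.flatSection_algebraic_of_flatSectionsAlgebraicQP_of_locallyQuasiProjective`; sharpens (J1)
(`IsQuasiProjectiveOver 𝒳`). [cite: CharlesSchnell2014Notes, Conj. 11.3.1] -/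
theorem variationalHodge_locallyQuasiProjective_of_variationalHodgeQP (hV : VariationalHodgeQP)
    ⦃n : ℕ⦄ ⦃𝒳 S : SchemeOver ℂ⦄ (f : 𝒳 ⟶ S) (hf : IsSmoothProjectiveFamily f n)
    (hirr : IrreducibleSpace S.left) (hsm : AlgebraicGeometry.Smooth S.hom)
    (hloc : ∀ x : S.left, ∃ U : S.left.Opens, x ∈ U ∧
      IsQuasiProjectiveOver (familyPullback f (openSubschemeOverι S U)))
    (p : ℕ) (A : complexBetti 𝒳 (2 * p))
    (hA : ∀ s : ComplexPoints S, IsRationalClass (complexBetti.map (fiberι f s) (2 * p) A) ∧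
      IsOfHodgeType n (fiberOver f s) (2 * p) p p (complexBetti.map (fiberι f s) (2 * p) A))
    (hs₀ : ∃ s₀ : ComplexPoints S, complexBetti.map (fiberι f s₀) (2 * p) A ∈ algebraicClasses (fiberOver f s₀) p)
    (s : ComplexPoints S) :
    complexBetti.map (fiberι f s) (2 * p) A ∈ algebraicClasses (fiberOver f s) p := by
  obtain ⟨s₀, hs₀⟩ := hs₀
  haveI := hirr
  haveI := hsm
  exact variationalHodge_conclusion_of_variationalHodgeQP_of_locallyQuasiProjectiveAt f hV hf p A hA
    (hloc s₀.pt) hs₀ s (hloc s.pt)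

/-- **(J5′, dictionary shape)** The same with the hypothesis in the exact shape `hloc` of ring2-b01's
`Ring2.Hypotheses.flatSections_locallyQuasiProjective_of_vhc` (open neighbourhoods `U` with BOTH `U` and `𝒳 ×_S U`
quasi-projective): the base conjunct is idle. [cite: CharlesSchnell2014Notes, Conj. 11.3.1] -/
theorem variationalHodge_locallyQuasiProjective_of_variationalHodgeQP' (hV : VariationalHodgeQP)
    ⦃n : ℕ⦄ ⦃𝒳 S : SchemeOver ℂ⦄ (f : 𝒳 ⟶ S) (hf : IsSmoothProjectiveFamily f n)
    (hirr : IrreducibleSpace S.left) (hsm : AlgebraicGeometry.Smooth S.hom)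
    (hloc : ∀ x : S.left, ∃ U : S.left.Opens, x ∈ U ∧ IsQuasiProjectiveOver (openSubschemeOver S U) ∧
      IsQuasiProjectiveOver (familyPullback f (openSubschemeOverι S U)))
    (p : ℕ) (A : complexBetti 𝒳 (2 * p))
    (hA : ∀ s : ComplexPoints S, IsRationalClass (complexBetti.map (fiberι f s) (2 * p) A) ∧
      IsOfHodgeType n (fiberOver f s) (2 * p) p p (complexBetti.map (fiberι f s) (2 * p) A))
    (hs₀ : ∃ s₀ : ComplexPoints S, complexBetti.map (fiberι f s₀) (2 * p) A ∈ algebraicClasses (fiberOver f s₀) p)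
    (s : ComplexPoints S) :
    complexBetti.map (fiberι f s) (2 * p) A ∈ algebraicClasses (fiberOver f s) p :=
  variationalHodge_locallyQuasiProjective_of_variationalHodgeQP hV f hf hirr hsm
    (fun x => (hloc x).imp fun _ h => ⟨h.1, h.2.2⟩) p A hA hs₀ s

/-- **XXVII's printed-carrier node IS the global-class statement for locally quasi-projective families over arbitrary
smooth irreducible bases** (`↔`; the converse direction takes `U = S`: the base change of a quasi-projective total
space along the open immersion `S ⊆ S` is quasi-projective, `Theorems.isQuasiProjectiveOver_familyPullback`, and forgets
the base clause of the node). Sharpens the junction's (J1′) `variationalHodgeQP_iff_quasiProjectiveTotal`.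
[cite: CharlesSchnell2014Notes, Conj. 11.3.1] -/
theorem variationalHodgeQP_iff_locallyQuasiProjective :
    VariationalHodgeQP ↔
      ∀ ⦃n : ℕ⦄ ⦃𝒳 S : SchemeOver ℂ⦄ (f : 𝒳 ⟶ S), IsSmoothProjectiveFamily f n →
        IrreducibleSpace S.left → AlgebraicGeometry.Smooth S.hom →
        (∀ x : S.left, ∃ U : S.left.Opens, x ∈ U ∧
          IsQuasiProjectiveOver (familyPullback f (openSubschemeOverι S U))) →
        ∀ (p : ℕ) (A : complexBetti 𝒳 (2 * p)),
          (∀ s : ComplexPoints S, IsRationalClass (complexBetti.map (fiberι f s) (2 * p) A) ∧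
            IsOfHodgeType n (fiberOver f s) (2 * p) p p (complexBetti.map (fiberι f s) (2 * p) A)) →
          (∃ s₀ : ComplexPoints S,
            complexBetti.map (fiberι f s₀) (2 * p) A ∈ algebraicClasses (fiberOver f s₀) p) →
          ∀ s : ComplexPoints S, complexBetti.map (fiberι f s) (2 * p) A ∈ algebraicClasses (fiberOver f s) p := by
  refine ⟨fun hV _ _ _ f hf hirr hsm hloc p A hA hs₀ s =>
      variationalHodge_locallyQuasiProjective_of_variationalHodgeQP hV f hf hirr hsm hloc p A hA hs₀ s,
    fun h => variationalHodgeQP_iff_quasiProjectiveTotal.2 fun _ 𝒳 S f hf h𝒳 hirr hsm p A hA hs₀ s => ?_⟩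
  refine h f hf hirr hsm (fun x => ⟨⊤, trivial, ?_⟩) p A hA hs₀ s
  haveI : IsOpenImmersion (openSubschemeOverι S ⊤).left :=
    inferInstanceAs (IsOpenImmersion (⊤ : S.left.Opens).ι)
  exact Theorems.isQuasiProjectiveOver_familyPullback f (openSubschemeOverι S ⊤) inferInstance h𝒳

/-! ## §4 (J5″) In particular: projective morphisms over ANY smooth irreducible base -/

/-- **(J5″) `VariationalHodgeQP` gives the global-class variational Hodge statement for every smooth family PROJECTIVE in
Hartshorne's sense** (`f` = a closed immersion `𝒳 ⟶ ℙᴺ × S` followed by the projection — the "smooth projective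
morphism" of Charles–Schnell Conj. 11.3.1 / Grothendieck 1966) **over ANY smooth irreducible base** (separated or not,
quasi-compact or not, NOT assumed quasi-projective; `𝒳` then need not be quasi-projective over `ℂ`). Count once: this
is (J1) over affine bases fed to the AnchorTransport route's `Theorems.variationalHodge_projective_of_quasiProjective`;
equivalently (J5′) with the affine neighbourhoods `U ∋ x`, over which `𝒳 ×_S U ↪ ℙᴺ × U` is closed
(`Motives.exists_isClosedImmersion_familyPullback`) hence quasi-projective
(`Theorems.isQuasiProjectiveOver_of_isClosedImmersion_of_isAffine`). Part XXVII had this only for `S` and `𝒳`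
quasi-projective. [cite: CharlesSchnell2014Notes, Conj. 11.3.1] [cite: Hartshorne1977, Ch. II §4 p. 103] -/
theorem variationalHodge_projective_of_variationalHodgeQP (hV : VariationalHodgeQP)
    ⦃n : ℕ⦄ ⦃𝒳 S : SchemeOver ℂ⦄ (f : 𝒳 ⟶ S) (hf : IsSmoothProjectiveFamily f n)
    (hι : ∃ (N : ℕ) (ι : 𝒳 ⟶ projectiveSpace N ℂ ⊗ S), IsClosedImmersion ι.left ∧
      ι ≫ CartesianMonoidalCategory.snd (projectiveSpace N ℂ) S = f)
    (hirr : IrreducibleSpace S.left) (hsm : AlgebraicGeometry.Smooth S.hom)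
    (p : ℕ) (A : complexBetti 𝒳 (2 * p))
    (hA : ∀ s : ComplexPoints S, IsRationalClass (complexBetti.map (fiberι f s) (2 * p) A) ∧
      IsOfHodgeType n (fiberOver f s) (2 * p) p p (complexBetti.map (fiberι f s) (2 * p) A))
    (hs₀ : ∃ s₀ : ComplexPoints S, complexBetti.map (fiberι f s₀) (2 * p) A ∈ algebraicClasses (fiberOver f s₀) p)
    (s : ComplexPoints S) :
    complexBetti.map (fiberι f s) (2 * p) A ∈ algebraicClasses (fiberOver f s) p :=
  Theorems.variationalHodge_projective_of_quasiProjective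
    (fun _ _ _ f' hf' h𝒳' hirr' _ hsm' p' A' hA' hs₀' s' =>
      variationalHodge_quasiProjective_of_variationalHodgeQP hV f' hf' h𝒳' hirr' hsm' p' A' hA' hs₀' s')
    f hf hι hirr hsm p A hA hs₀ s

/-! ## §5 (J7) Exactness of row b03 against its printed-carrier node — non-vacuous form -/

/-- **(J7) Row b03 = its printed-carrier node + the instances with a non-locally-projective endpoint, EXACTLY.**
`VariationalHodge` (item 1076, all smooth proper families with projective fibres over all smooth irreducible bases) is
equivalent to the conjunction of `VariationalHodgeQP` (Conj. 11.3.1 on its printed carriers) and the instances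
`(f, A, s₀, s)` of item 1076 in which the anchor `pt s₀` or the target `pt s` has NO open neighbourhood over which the
family is quasi-projective. `→`: XXVII's restriction `variationalHodgeQP_of_vhc` and specialisation; `←`: if both
endpoints are locally quasi-projective use (J5), otherwise the second conjunct. Unlike the `hqp`-theorems (J3)/(J4) of
the junction (vacuous: blanket `hqp` is false, F-ref2-67), the second conjunct here is a set of INSTANCES of the
crux — implied by the Hodge conjecture (`Ring2.Hypotheses.vhc_of_hodgeConjecture`), empty for families projective in
Hartshorne's sense and for abelian schemes over normal curve bases (Raynaud 1970, XI 1.4), inhabited as a class of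
carriers by the mixed small resolutions of two-nodal quartic pencils (Atiyah 1958; schematic when the pencil has a base
line through both nodes, see the module docstring) — on which the printed conjecture is silent. [cite: CharlesSchnell2014Notes, Conj. 11.3.1] [cite: Grothendieck1966, footnote 13] [cite: Atiyah1958, §4]
[cite: Raynaud1970, Ch. XI] -/
theorem vhc_iff_variationalHodgeQP_and_nonLocallyProjectiveEndpoints :
    Theses.AnchorTransport.VariationalHodge ↔
      (VariationalHodgeQP ∧
        ∀ ⦃n : ℕ⦄ ⦃𝒳 S : SchemeOver ℂ⦄ (f : 𝒳 ⟶ S), IsSmoothProjectiveFamily f n →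
          IrreducibleSpace S.left → AlgebraicGeometry.Smooth S.hom →
          ∀ (p : ℕ) (A : complexBetti 𝒳 (2 * p)),
            (∀ s : ComplexPoints S, IsRationalClass (complexBetti.map (fiberι f s) (2 * p) A) ∧
              IsOfHodgeType n (fiberOver f s) (2 * p) p p (complexBetti.map (fiberι f s) (2 * p) A)) →
            ∀ s₀ s : ComplexPoints S,
              ¬ ((∃ U : S.left.Opens, s₀.pt ∈ U ∧
                    IsQuasiProjectiveOver (familyPullback f (openSubschemeOverι S U))) ∧
                  (∃ U : S.left.Opens, s.pt ∈ U ∧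
                    IsQuasiProjectiveOver (familyPullback f (openSubschemeOverι S U)))) →
              complexBetti.map (fiberι f s₀) (2 * p) A ∈ algebraicClasses (fiberOver f s₀) p →
              complexBetti.map (fiberι f s) (2 * p) A ∈ algebraicClasses (fiberOver f s) p) := by
  refine ⟨fun hV => ⟨variationalHodgeQP_of_vhc hV, fun _ _ _ f hf hirr hsm p A hA s₀ s _ hs₀ =>
      hV f hf hirr hsm p A hA ⟨s₀, hs₀⟩ s⟩, fun ⟨hV, hR⟩ _ 𝒳 S f hf hirr hsm p A hA hs₀ s => ?_⟩
  obtain ⟨s₀, hs₀⟩ := hs₀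
  by_cases hloc :
      (∃ U : S.left.Opens, s₀.pt ∈ U ∧ IsQuasiProjectiveOver (familyPullback f (openSubschemeOverι S U))) ∧
        (∃ U : S.left.Opens, s.pt ∈ U ∧ IsQuasiProjectiveOver (familyPullback f (openSubschemeOverι S U)))
  · haveI := hirr
    haveI := hsm
    exact variationalHodge_conclusion_of_variationalHodgeQP_of_locallyQuasiProjectiveAt f hV hf p A hA
      hloc.1 hs₀ s hloc.2
  · exact hR f hf hirr hsm p A hA s₀ s hloc hs₀

/-- **(J7, flat-section form)** the same with Charles–Schnell's Conj. 11.3.1 VERBATIM carriers (`FlatSectionsAlgebraicQP`,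
XXVII `flatSectionsAlgebraicQP_iff_variationalHodgeQP`) as the printed node. [cite: CharlesSchnell2014Notes, Conj. 11.3.1 and proof of Prop. 11.3.5] -/
theorem vhc_iff_flatSectionsAlgebraicQP_and_nonLocallyProjectiveEndpoints :
    Theses.AnchorTransport.VariationalHodge ↔
      (FlatSectionsAlgebraicQP ∧
        ∀ ⦃n : ℕ⦄ ⦃𝒳 S : SchemeOver ℂ⦄ (f : 𝒳 ⟶ S), IsSmoothProjectiveFamily f n →
          IrreducibleSpace S.left → AlgebraicGeometry.Smooth S.hom →
          ∀ (p : ℕ) (A : complexBetti 𝒳 (2 * p)),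
            (∀ s : ComplexPoints S, IsRationalClass (complexBetti.map (fiberι f s) (2 * p) A) ∧
              IsOfHodgeType n (fiberOver f s) (2 * p) p p (complexBetti.map (fiberι f s) (2 * p) A)) →
            ∀ s₀ s : ComplexPoints S,
              ¬ ((∃ U : S.left.Opens, s₀.pt ∈ U ∧
                    IsQuasiProjectiveOver (familyPullback f (openSubschemeOverι S U))) ∧
                  (∃ U : S.left.Opens, s.pt ∈ U ∧
                    IsQuasiProjectiveOver (familyPullback f (openSubschemeOverι S U)))) →
              complexBetti.map (fiberι f s₀) (2 * p) A ∈ algebraicClasses (fiberOver f s₀) p →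
              complexBetti.map (fiberι f s) (2 * p) A ∈ algebraicClasses (fiberOver f s) p) := by
  rw [vhc_iff_variationalHodgeQP_and_nonLocallyProjectiveEndpoints, flatSectionsAlgebraicQP_iff_variationalHodgeQP]

/-! ## Audit

No named fact, no `HC_CM`, no definition: every theorem is an unconditional kernel implication between nodes already
typed in the tree (`VariationalHodgeQP` / `FlatSectionsAlgebraicQP` of part XXVII, the crux `VariationalHodge` of route
AnchorTransport) and per-instance local-quasi-projectivity hypotheses (satisfiable: every Hartshorne-projective
family). Axiom closures: the three standard axioms only. -/

#print axioms Summit.HodgeConjecture.HodgeConjecture.Ring2.Binders.variationalHodge_conclusion_of_variationalHodgeQP_of_locallyQuasiProjectiveAt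
#print axioms Summit.HodgeConjecture.HodgeConjecture.Ring2.Binders.variationalHodgeQP_iff_locallyQuasiProjective
#print axioms Summit.HodgeConjecture.HodgeConjecture.Ring2.Binders.vhc_iff_variationalHodgeQP_and_nonLocallyProjectiveEndpoints

end Summit.HodgeConjecture.HodgeConjecture.Ring2.Binders

end
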